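import Mathlib.FieldTheory.KrullTopology
import Mathlib.FieldTheory.Galois.Profinite
import Mathlib.LinearAlgebra.Matrix.Permutation
import Literature.NumberTheory.Automorphic.TunnellLemma
import Literature.NumberTheory.GaloisRepresentations.AbsGaloisGroup
import HarnessLib

/-!
# Frobenius elements are dense in `Γ_K` (from Chebotarev's density theorem)

Topic `Literature/NumberTheory/GaloisRepresentations` (trunk GalRep vocabulary: `absIntegers`,
`HeightOneSpectrum.primesAbove`, `IsArithFrobAt`, `Field.absoluteGaloisGroup`).  A *proofs*
file (theorems only): the classical corollary of Chebotarev's density theorem that for a number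
field `K` and a finite set `S` of finite places, the arithmetic Frobenius elements
`σ ∈ Γ_K = Gal(K̄/K)` at the primes `𝔓` of `\bar ℤ_K` above the places `v ∉ S` form a **dense**
subset of `Γ_K` (Serre, *Abelian `ℓ`-adic representations*, Ch. I §2.2, Cor. 2 (a) of
Chebotarev's theorem; for `K = ℚ` Diamond–Shurman, *A First Course in Modular Forms*,
Thm. 9.3.1), **proved** from the tree's named fact `Literature.NumberTheory.Automorphic.chebotarev_artinRep`
(`Literature.NumberTheory.Automorphic.TunnellLemma`: Chebotarev in existence form for Artin
representations of `Γ_F`, `F` any number field, after Tate, *Global class field theory*, §2.4).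

* `Literature.NumberTheory.GaloisRepresentations.AlgEquiv.dense_of_forall_exists_mem_fixingSubgroup` — density criterion in the Krull
  topology: `D ⊆ Gal(L/K)` (`L/K` normal) is dense as soon as every `σ` agrees with some
  `τ ∈ D` on every finite normal subextension `E` (Mathlib
  `krullTopology_mem_nhds_one_iff_of_normal`).
* `Literature.NumberTheory.GaloisRepresentations.absoluteGaloisGroup.exists_framedArtinRep_restrictNormalHom_eq` — for a finite normal
  subextension `E ⊆ K̄` there is an Artin representation `ρ : Γ_K → GL_N(ℂ)` (the regular
  permutation representation of `Gal(E/K)`, Mathlib `MulAction.toPermHom` and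
  `Matrix.permMatrixHom`, inflated along `AlgEquiv.restrictNormalHom E`, continuous by Mathlib
  `InfiniteGalois.restrictNormalHom_continuous`) with `ρ φ = ρ g → φ|_E = g|_E`.
* `Literature.NumberTheory.GaloisRepresentations.absoluteGaloisGroup.frobenius_dense` — the density statement, from
  `chebotarev_artinRep` applied to this `ρ` and `g := σ`: among the infinitely many places `v`
  carrying an arithmetic Frobenius `φ` with `ρ φ = ρ σ` one lies outside `S`, and then
  `σ⁻¹ φ ∈ Gal(K̄/E)`.

This is the input "Frobenius elements are dense" of the uniqueness statement for semisimple
Galois representations with prescribed Frobenius characteristic polynomials (Chebotarev +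
Brauer–Nesbitt; Deligne–Serre 1974, Lemme 3.2), `GaloisRepresentations/LAdicRepFrobenius`,
used for the uniqueness clause of Harris–Lan–Taylor–Thorne's Thm. A
(`Automorphic/ReciprocityGLnProofs`).  Related tree material: the `ℚ`-only Dirichlet-density
form `Literature.NumberTheory.LFunctions.Chebotarev.dirichletDensity_eq` (`LFunctions/ChebotarevDensity`) with
`Literature.NumberTheory.GaloisRepresentations.DeligneSerre1974.exists_frob_eq` (`ArtinRepFrobeniusProofs`), and the finite-level
restriction API `IntermediateField.integralClosureToAbsIntegers`, `absRestrictNormalHom`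
(`RamificationFiltration`), none of which is needed here.

## References

* J.-P. Serre, *Abelian ℓ-adic representations and elliptic curves*, Benjamin (1968), Ch. I
  §2.2, Cor. 2. [SerreAbelianLadic1968]
* J. Tate, *Global class field theory*, in Cassels–Fröhlich (1967), Ch. VII §2.4.
  [TateGCFT1967]
* F. Diamond, J. Shurman, *A First Course in Modular Forms*, GTM 228 (2005), Thm. 9.3.1.
-/

noncomputable section

open scoped NumberField Topology
open IsDedekindDomain Field

namespace Literature.NumberTheory.GaloisRepresentations

/-! ### A density criterion in the Krull topology -/

section Krull

variable {K L : Type*} [Field K] [Field L] [Algebra K L]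

/-- **Density criterion in the Krull topology**: a subset `D` of `Gal(L/K)` (`L/K` normal) is
dense as soon as for every `σ` and every finite normal subextension `E`, some `τ ∈ D` agrees
with `σ` on `E`, i.e. `σ⁻¹ τ ∈ Gal(L/E)` (Mathlib `krullTopology_mem_nhds_one_iff_of_normal`:
the `Gal(L/E)` form a neighbourhood basis of `1`). [folklore] -/
theorem AlgEquiv.dense_of_forall_exists_mem_fixingSubgroup [Normal K L] {D : Set Gal(L/K)}
    (h : ∀ (σ : Gal(L/K)) (E : IntermediateField K L), FiniteDimensional K E → Normal K E →
      ∃ τ ∈ D, σ⁻¹ * τ ∈ E.fixingSubgroup) :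
    Dense D := by
  rw [dense_iff_inter_open]
  rintro U hU ⟨σ, hσ⟩
  have hV : (fun τ ↦ σ * τ) ⁻¹' U ∈ 𝓝 (1 : Gal(L/K)) := by
    refine (hU.preimage (continuous_const_mul σ)).mem_nhds ?_
    simpa using hσ
  obtain ⟨E, hfin, hnorm, hE⟩ := (krullTopology_mem_nhds_one_iff_of_normal K L _).1 hV
  obtain ⟨τ, hτD, hτ⟩ := h σ E hfin hnorm
  refine ⟨τ, ?_, hτD⟩
  have : σ * (σ⁻¹ * τ) ∈ U := hE hτ
  simpa using this

end Krull

/-! ### A faithful Artin representation of a finite quotient `Gal(E/K)` -/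

section Artin

variable {K : Type} [Field K]

/-- **A faithful Artin representation of `Gal(E/K)` inflated to `Γ_K`.**  For a finite normal
subextension `E ⊆ K̄` there are `N` and a continuous `ρ : Γ_K → GL_N(ℂ)` such that
`ρ φ = ρ g` forces `φ|_E = g|_E`: the regular permutation representation of the finite group
`G = Gal(E/K)` by permutation matrices on `Fin #G` (Mathlib `MulAction.toPermHom`,
`Equiv.permCongrHom`, `Matrix.permMatrixHom`; faithful since left multiplication is and a
permutation matrix determines the permutation, `PEquiv.toMatrix_injective`), composed with
the restriction map `Γ_K → Gal(E/K)` (Mathlib `AlgEquiv.restrictNormalHom`, continuous for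
the Krull topologies by `InfiniteGalois.restrictNormalHom_continuous`, the target being
discrete). [folklore] -/
theorem absoluteGaloisGroup.exists_framedArtinRep_restrictNormalHom_eq
    (E : IntermediateField K (AlgebraicClosure K)) [FiniteDimensional K E] [Normal K E] :
    ∃ (N : ℕ) (ρ : FramedArtinRep K N), ∀ φ g : absoluteGaloisGroup K, ρ φ = ρ g →
      AlgEquiv.restrictNormalHom E (absoluteGaloisGroup.toAlgEquiv K φ) =
        AlgEquiv.restrictNormalHom E (absoluteGaloisGroup.toAlgEquiv K g) := by
  classical
  -- the regular permutation representation `π` of `G = Gal(E/K)` on `Fin #G`, faithful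
  let e := Fintype.equivFin (E ≃ₐ[K] E)
  let π : (E ≃ₐ[K] E) →* GL (Fin (Fintype.card (E ≃ₐ[K] E))) ℂ :=
    ((Matrix.permMatrixHom (R := ℂ)).comp
      (e.permCongrHom.toMonoidHom.comp (MulAction.toPermHom (E ≃ₐ[K] E) (E ≃ₐ[K] E)))).toHomUnits
  have hπ : Function.Injective π := by
    intro g h hgh
    have h1 := congrArg Units.val hgh
    simp only [π, MonoidHom.coe_toHomUnits, MonoidHom.coe_comp, Function.comp_apply,
      Matrix.permMatrixHom_apply, MulEquiv.coe_toMonoidHom] at h1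
    have h2 := PEquiv.toMatrix_injective h1
    have h3 : e.permCongrHom (MulAction.toPermHom _ _ g) =
        e.permCongrHom (MulAction.toPermHom _ _ h) := by
      refine inv_injective (Equiv.ext fun x ↦ ?_)
      have hx := congrArg (fun f : PEquiv _ _ ↦ f x) h2
      simpa only [Equiv.toPEquiv_apply, Option.some.injEq] using hx
    exact MulAction.toPerm_injective (e.permCongrHom.injective h3)
  -- the restriction `Γ_K → Gal(E/K)`, continuous (Krull topologies; the target is discrete)
  let r : absoluteGaloisGroup K →* (E ≃ₐ[K] E) :=
    (AlgEquiv.restrictNormalHom E).comp (absoluteGaloisGroup.toAlgEquiv K).toMonoidHom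
  have hr : Continuous r := InfiniteGalois.restrictNormalHom_continuous (k := K) E
  have hρ : Continuous (π.comp r) := (continuous_of_discreteTopology (f := π)).comp hr
  exact ⟨Fintype.card (E ≃ₐ[K] E), ⟨π.comp r, hρ⟩, fun φ g h ↦ hπ h⟩

end Artin

/-! ### Frobenius elements are dense in `Γ_K` -/

/-- **The arithmetic Frobenius elements at places outside any finite set are dense in `Γ_K`**
(Serre, *Abelian `ℓ`-adic representations*, I-2.2, Cor. 2 (a); for `K = ℚ` Diamond–Shurman,
Thm. 9.3.1), deduced from Chebotarev's density theorem in the Artin-representation existence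
form `Literature.NumberTheory.Automorphic.chebotarev_artinRep` (hypothesis `hC`): for a number field `K` and a finite
set `S` of finite places, the set of `σ ∈ Γ_K` which are an arithmetic Frobenius
(`IsArithFrobAt (𝓞 K) σ 𝔓`) at some prime `𝔓 ∈ v.primesAbove` of `\bar ℤ_K` over some `v ∉ S`
is dense for the Krull topology.  Proof: by the density criterion it suffices, given `σ` and a
finite normal `E ⊆ K̄`, to find such a Frobenius `φ` with `φ|_E = σ|_E`; apply `hC` to the
faithful Artin representation `ρ` of `Gal(E/K)` (`exists_framedArtinRep_restrictNormalHom_eq`)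
and `g := σ`: infinitely many places carry a Frobenius `φ` with `ρ φ = ρ σ`, one of them
outside `S`. [cite: SerreAbelianLadic1968, Ch. I §2.2, Cor. 2 (a)] -/
theorem absoluteGaloisGroup.frobenius_dense (hC : Automorphic.chebotarev_artinRep)
    (K : Type) [Field K] [NumberField K] (S : Set (HeightOneSpectrum (𝓞 K))) (hS : S.Finite) :
    Dense {σ : absoluteGaloisGroup K |
      ∃ v ∉ S, ∃ 𝔓 ∈ v.primesAbove, IsArithFrobAt (𝓞 K) σ 𝔓} := by
  have key : ∀ (σ : absoluteGaloisGroup K) (E : IntermediateField K (AlgebraicClosure K)),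
      FiniteDimensional K E → Normal K E →
      ∃ τ ∈ {σ : absoluteGaloisGroup K | ∃ v ∉ S, ∃ 𝔓 ∈ v.primesAbove, IsArithFrobAt (𝓞 K) σ 𝔓},
        (absoluteGaloisGroup.toAlgEquiv K σ)⁻¹ * absoluteGaloisGroup.toAlgEquiv K τ ∈
          E.fixingSubgroup := by
    intro σ E hfin hnorm
    obtain ⟨N, ρ, hρ⟩ := absoluteGaloisGroup.exists_framedArtinRep_restrictNormalHom_eq E
    -- Chebotarev: infinitely many places carry a Frobenius `φ` with `ρ φ = ρ σ`; pick one `∉ S`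
    obtain ⟨v, ⟨-, 𝔓, h𝔓, φ, hφ, hρφ⟩, hvS⟩ := ((hC K N ρ σ).sdiff hS).nonempty
    refine ⟨φ, ⟨v, hvS, 𝔓, h𝔓, hφ⟩, ?_⟩
    have heq := hρ φ σ hρφ
    -- so `σ⁻¹ φ` fixes `E` pointwise
    rw [IntermediateField.mem_fixingSubgroup_iff]
    intro x hx
    have h1 := AlgEquiv.restrictNormalHom_apply E (absoluteGaloisGroup.toAlgEquiv K φ) ⟨x, hx⟩
    have h2 := AlgEquiv.restrictNormalHom_apply E (absoluteGaloisGroup.toAlgEquiv K σ) ⟨x, hx⟩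
    rw [heq] at h1
    have h12 : absoluteGaloisGroup.toAlgEquiv K φ x = absoluteGaloisGroup.toAlgEquiv K σ x :=
      h1.symm.trans h2
    rw [AlgEquiv.mul_apply, AlgEquiv.aut_inv, AlgEquiv.symm_apply_eq]
    exact h12
  -- `absoluteGaloisGroup K` is `K̄ ≃ₐ[K] K̄` with the Krull topology and `toAlgEquiv` is the
  -- identity, so the Krull density criterion applies verbatim
  exact AlgEquiv.dense_of_forall_exists_mem_fixingSubgroup
    (K := K) (L := AlgebraicClosure K) fun σ E hfin hnorm ↦ key σ E hfin hnorm

end Literature.NumberTheory.GaloisRepresentations
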